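import Summits.ValiantsHypothesis.ValiantsHypothesis.Theorems.DepthWindowRefreshTools

/-!
# Route `DepthWindow` — the refresh level with a frozen carrier (core)

Cone-free theorem (decomp-valiant lens 4, g16→g17) supporting the crux item `HomImmHardTwoOne`
(stmt-ValiantsHypothesis-30635): level B of the CARRIER round (`CarrierRound`, `DepthWindowULPBReduction.lean`;
NODE-v16 `CARRIER-ROUND-PLAN.md`).  The refresh of `DepthWindowRefresh.lean`, run only on a set `W` of working
letters (letters outside `W` — the carrier — stay singletons and are nobody's leader), at the round's scale
(`|z_j| ≤ v` on `W`, lighter big side of mass `≤ M`), exporting: masses `≤ 2M + 2v`; every `W`-group `|sum| ≤ v`;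
and the NO-OVERSHOOT inequality `Σ_{stale}|sum| + |Σ_W z − Σ_{stale} sum| ≤ |Σ_W z|` over the stale groups
(`|sum| > e`): they all have the sign of `Σ_W z` and total modulus `≤ |Σ_W z|` — invariant `I2` of `CarrierRound`
at the next scale.  This file: `exists_carrierRefresh_core` (positive-lighter normal form, some big letter
present); the wrapper `exists_carrierRefresh` is in `DepthWindowCarrierRefresh.lean`.

References: [LimayeSrinivasanTavenas2022] full version ECCC TR22-090, Lemma 21 / Algorithm 1, Prop. 17;
[BhargavDuttaSaxena2024] ACM ToCT 16(4):23 §5.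
-/

-- layout Summits/ValiantsHypothesis/ValiantsHypothesis forces the duplicated namespace component
set_option linter.dupNamespace false

namespace Summit.ValiantsHypothesis.ValiantsHypothesis.Theorems.DepthWindow.TreeBias

open Finset

variable {n : ℕ}

/-- **Carrier refresh (core, positive-lighter form).**  See the module docstring. [folklore] -/
theorem exists_carrierRefresh_core (z : Fin n → ℤ) (W : Finset (Fin n)) {v e M : ℕ}
    (hz : ∀ j ∈ W, |z j| ≤ v)
    (hQ : ∑ j ∈ W.filter (fun j => (e : ℤ) < z j), z j ≤ M)
    (hQQ : ∑ j ∈ W.filter (fun j => (e : ℤ) < z j), z j +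
      ∑ j ∈ W.filter (fun j => z j < -(e : ℤ)), z j ≤ 0)
    (hPN : (W.filter (fun j => (e : ℤ) < z j) ∪ W.filter (fun j => z j < -(e : ℤ))).Nonempty) :
    ∃ L : Fin n → Fin n, (∀ i, L (L i) = L i) ∧
      (∀ i, i ∉ W → ∀ j, L j = i ↔ j = i) ∧
      (∀ i ∈ W, ∑ j ∈ univ.filter (fun j => L j = L i), |z j| ≤ 2 * M + 2 * v) ∧
      (∀ i ∈ W, |∑ j ∈ univ.filter (fun j => L j = L i), z j| ≤ v) ∧
      (∑ i ∈ univ.filter (fun i => i ∈ W ∧ L i = i ∧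
          (e : ℤ) < |∑ j ∈ univ.filter (fun j => L j = i), z j|),
          |∑ j ∈ univ.filter (fun j => L j = i), z j|) +
        |∑ j ∈ W, z j - ∑ i ∈ univ.filter (fun i => i ∈ W ∧ L i = i ∧
          (e : ℤ) < |∑ j ∈ univ.filter (fun j => L j = i), z j|),
          ∑ j ∈ univ.filter (fun j => L j = i), z j| ≤ |∑ j ∈ W, z j| := by
  classical
  -- the four kinds of working letters
  set P := W.filter (fun j => (e : ℤ) < z j) with hP
  set Nn := W.filter (fun j => z j < -(e : ℤ)) with hNn
  set Pool := W.filter (fun j => 0 ≤ z j ∧ z j ≤ (e : ℤ)) with hPool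
  set Gm := W.filter (fun j => -(e : ℤ) ≤ z j ∧ z j < 0) with hGm
  have he0 : (0 : ℤ) ≤ e := Nat.cast_nonneg e
  have hv0 : (0 : ℤ) ≤ v := Nat.cast_nonneg v
  have hzlo : ∀ j ∈ W, -(v : ℤ) ≤ z j := fun j hj => (abs_le.1 (hz j hj)).1
  have hzhi : ∀ j ∈ W, z j ≤ v := fun j hj => (abs_le.1 (hz j hj)).2
  have hPW : P ⊆ W := filter_subset _ _
  have hNnW : Nn ⊆ W := filter_subset _ _
  have hPoolW : Pool ⊆ W := filter_subset _ _
  have hdPN : Disjoint P Nn := by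
    rw [hP, hNn]; exact disjoint_filter.2 fun j _ h1 h2 => by linarith
  have hsplit : ∑ j ∈ W, z j = ∑ j ∈ P, z j + ∑ j ∈ Nn, z j + ∑ j ∈ Pool, z j + ∑ j ∈ Gm, z j := by
    have hd1 : Disjoint P Nn := hdPN
    have hd2 : Disjoint (P ∪ Nn) Pool := by
      rw [disjoint_union_left]
      exact ⟨disjoint_filter.2 fun j _ h1 h2 => by linarith, disjoint_filter.2 fun j _ h1 h2 => by linarith⟩
    have hd3 : Disjoint (P ∪ Nn ∪ Pool) Gm := by
      rw [disjoint_union_left, disjoint_union_left]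
      exact ⟨⟨disjoint_filter.2 fun j _ h1 h2 => by linarith, disjoint_filter.2 fun j _ h1 h2 => by linarith⟩,
        disjoint_filter.2 fun j _ h1 h2 => by linarith⟩
    have hu : W = P ∪ Nn ∪ Pool ∪ Gm := by
      ext j
      simp only [mem_union, mem_filter, hP, hNn, hPool, hGm]
      by_cases hj : j ∈ W
      · simp only [hj, true_and, true_iff]; omega
      · simp [hj]
    rw [← sum_union hd1, ← sum_union hd2, ← sum_union hd3, ← hu]
  set Q := ∑ j ∈ P, z j with hQdef
  have hQ0 : 0 ≤ Q := sum_nonneg fun j hj => by have := (mem_filter.1 hj).2; linarith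
  have hM0 : (0 : ℤ) ≤ M := Nat.cast_nonneg M
  have hGm0 : ∑ j ∈ Gm, z j ≤ 0 := sum_nonpos fun j hj => (mem_filter.1 hj).2.2.le

  -- greedy absorption of negative letters into the positive block
  obtain ⟨T, hTN, hs₀lo, hs₀hi, hN₀⟩ : ∃ T ⊆ Nn,
      -(v : ℤ) ≤ Q + ∑ j ∈ T, z j ∧ Q + ∑ j ∈ T, z j ≤ 0 ∧ (P ∪ T).Nonempty := by
    obtain ⟨T, hTN, hT⟩ := exists_greedy_absorb z hQ0 Nn (h := v) fun j hj => hzlo j (hNnW hj)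
    rcases hT with ⟨hTeq, hpos⟩ | ⟨hlo, hhi⟩
    · exfalso; rw [hTeq] at hpos; linarith
    · rcases (P ∪ T).eq_empty_or_nonempty with hPT | hPT
      · -- `P = T = ∅`: absorb one negative letter by hand
        have hP0 : P = ∅ := subset_empty.1 (hPT ▸ subset_union_left)
        have hQz : Q = 0 := by rw [hQdef, hP0, sum_empty]
        obtain ⟨m, hm⟩ : Nn.Nonempty := by
          rcases Nn.eq_empty_or_nonempty with h0 | h0
          · rw [hP0, h0, union_empty] at hPN; exact absurd rfl hPN.ne_empty
          · exact h0
        refine ⟨{m}, singleton_subset_iff.2 hm, ?_, ?_, ⟨m, mem_union_right _ (mem_singleton_self m)⟩⟩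
        · rw [sum_singleton, hQz, zero_add]; exact hzlo m (hNnW hm)
        · rw [sum_singleton, hQz, zero_add]; have := (mem_filter.1 hm).2; linarith
      · exact ⟨T, hTN, hlo, hhi, hPT⟩
  set s₀ := Q + ∑ j ∈ T, z j with hs₀def
  set a₀ := (P ∪ T).min' hN₀ with ha₀def
  have ha₀ : a₀ ∈ P ∪ T := min'_mem _ hN₀
  have hPTW : P ∪ T ⊆ W := union_subset hPW (hTN.trans hNnW)
  have ha₀W : a₀ ∈ W := hPTW ha₀
  set X := Nn \ T with hXdef
  have hXW : X ⊆ W := sdiff_subset.trans hNnW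
  -- start values of the targets: `s₀` for the block (represented by `a₀`), `z x` for `x ∈ X`
  let s : Fin n → ℤ := fun j => if j = a₀ then s₀ else z j
  have hPpos : ∀ j ∈ P, (e : ℤ) < z j := fun j hj => (mem_filter.1 hj).2
  have hNneg : ∀ j ∈ Nn, z j < -(e : ℤ) := fun j hj => (mem_filter.1 hj).2
  have hPT_notPool : ∀ j ∈ P ∪ T, j ∉ Pool := by
    intro j hj hjp
    have hp := (mem_filter.1 hjp).2
    rcases mem_union.1 hj with h1 | h1
    · have := hPpos j h1; linarith
    · have := hNneg j (hTN h1); linarith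
  have hX_notPool : ∀ x ∈ X, x ∉ Pool := fun x hx hxp => by
    have := hNneg x (mem_sdiff.1 hx).1; have := (mem_filter.1 hxp).2; linarith
  have hX_notPT : ∀ x ∈ X, x ∉ P ∪ T := by
    intro x hx hxPT
    rcases mem_union.1 hxPT with h1 | h1
    · have := hPpos x h1; have := hNneg x (mem_sdiff.1 hx).1; linarith
    · exact (mem_sdiff.1 hx).2 h1
  have ha₀X : a₀ ∉ X := fun h => hX_notPT a₀ h ha₀
  have hXa₀ : ∀ x ∈ X, x ≠ a₀ := fun x hx h => ha₀X (h ▸ hx)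
  set Tg := insert a₀ X with hTgdef
  have hTgW : Tg ⊆ W := insert_subset ha₀W hXW
  have hsTg : ∀ t ∈ Tg, s t ≤ 0 := by
    intro t ht
    rcases mem_insert.1 ht with rfl | ht
    · simp [s, hs₀hi]
    · simp only [s, if_neg (hXa₀ t ht)]; have := hNneg t (mem_sdiff.1 ht).1; linarith
  have hdisj : Disjoint Tg Pool := by
    rw [hTgdef, disjoint_insert_left]
    exact ⟨hPT_notPool a₀ ha₀, disjoint_left.2 fun x hx hxp => hX_notPool x hx hxp⟩
  obtain ⟨τ, Used, hUP, hτ, hprop⟩ := exists_multiTrim z s e Tg hsTg Pool hdisj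
    (fun j hj => (mem_filter.1 hj).2.1) (fun j hj => (mem_filter.1 hj).2.2)
  have hUsed_notPT : ∀ j ∈ Used, j ∉ P ∪ T := fun j hj h => hPT_notPool j h (hUP hj)
  have hUsed0 : ∀ j ∈ Used, 0 ≤ z j := fun j hj => (mem_filter.1 (hUP hj)).2.1
  have hτne : ∀ j ∈ Used, τ j ≠ j := fun j hj h =>
    disjoint_left.1 hdisj (hτ j hj) (h.symm ▸ hUP hj : τ j ∈ Pool) |>.elim
  -- the leader map
  let L : Fin n → Fin n := fun j => if j ∈ P ∪ T then a₀ else if j ∈ Used then τ j else j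
  have hL_PT : ∀ j ∈ P ∪ T, L j = a₀ := fun j hj => by
    show (if j ∈ P ∪ T then a₀ else if j ∈ Used then τ j else j) = a₀; rw [if_pos hj]
  have hL_U : ∀ j ∈ Used, L j = τ j := fun j hj => by
    show (if j ∈ P ∪ T then a₀ else if j ∈ Used then τ j else j) = τ j
    rw [if_neg (hUsed_notPT j hj), if_pos hj]
  have hL_o : ∀ j, j ∉ P ∪ T → j ∉ Used → L j = j := fun j h1 h2 => by
    show (if j ∈ P ∪ T then a₀ else if j ∈ Used then τ j else j) = j
    rw [if_neg h1, if_neg h2]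
  have hsa : s a₀ = s₀ := by simp [s]
  have hsX : ∀ x ∈ X, s x = z x := fun x hx => by simp [s, if_neg (hXa₀ x hx)]
  have hLa₀ : L a₀ = a₀ := hL_PT a₀ ha₀
  have hLX : ∀ x ∈ X, L x = x := fun x hx => hL_o x (hX_notPT x hx) fun h => hX_notPool x hx (hUP h)
  have hLTg : ∀ t ∈ Tg, L t = t := fun t ht => by
    rcases mem_insert.1 ht with rfl | ht
    · exact hLa₀
    · exact hLX t ht
  have hLW : ∀ i ∈ W, L i ∈ W := by
    intro i hi
    by_cases h1 : i ∈ P ∪ T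
    · rw [hL_PT i h1]; exact ha₀W
    · by_cases h2 : i ∈ Used
      · rw [hL_U i h2]; exact hTgW (hτ i h2)
      · rw [hL_o i h1 h2]; exact hi
  -- fibres: of the block leader, and of any other leader
  have hfib₀ : univ.filter (fun j => L j = a₀) = (P ∪ T) ∪ Used.filter (fun j => τ j = a₀) := by
    ext j
    rw [mem_filter, mem_union, mem_filter]
    simp only [mem_univ, true_and]
    by_cases h1 : j ∈ P ∪ T
    · rw [hL_PT j h1]; exact ⟨fun _ => Or.inl h1, fun _ => rfl⟩
    · by_cases h2 : j ∈ Used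
      · rw [hL_U j h2]
        exact ⟨fun h => Or.inr ⟨h2, h⟩, fun h => h.elim (fun h' => absurd h' h1) fun h' => h'.2⟩
      · rw [hL_o j h1 h2]
        refine ⟨fun h => absurd (by rw [h]; exact ha₀) h1, fun h => h.elim (fun h' => absurd h' h1) ?_⟩
        exact fun h' => absurd h'.1 h2
  have hfib₁ : ∀ t, t ∉ P ∪ T → t ∉ Used →
      univ.filter (fun j => L j = t) = insert t (Used.filter (fun j => τ j = t)) := by
    intro t ht1 ht2
    ext j
    rw [mem_filter, mem_insert, mem_filter]
    simp only [mem_univ, true_and]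
    by_cases h1 : j ∈ P ∪ T
    · rw [hL_PT j h1]
      constructor
      · intro h; exact absurd (by rw [← h]; exact ha₀) ht1
      · rintro (rfl | ⟨h, _⟩)
        · exact absurd h1 ht1
        · exact absurd h1 (hUsed_notPT j h)
    · by_cases h2 : j ∈ Used
      · rw [hL_U j h2]
        constructor
        · intro h; exact Or.inr ⟨h2, h⟩
        · rintro (rfl | ⟨_, h⟩)
          · exact absurd h2 ht2
          · exact h
      · rw [hL_o j h1 h2]
        constructor
        · intro h; exact Or.inl h
        · rintro (h | ⟨h, _⟩)
          · exact h
          · exact absurd h h2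
  -- the residual values of the targets
  have hres : ∀ t ∈ Tg, ∑ j ∈ univ.filter (fun j => L j = t), z j =
      s t + ∑ j ∈ Used.filter (fun j => τ j = t), z j := by
    intro t ht
    rcases mem_insert.1 ht with rfl | htX
    · rw [hfib₀, sum_union (disjoint_left.2 fun j hj hju => hUsed_notPT j (mem_filter.1 hju).1 hj),
        sum_union (disjoint_left.2 fun j hj hjT => ?_)]
      · rw [hsa, hs₀def, hQdef]
      · exact disjoint_left.1 hdPN hj (hTN hjT)
    · rw [hfib₁ _ (hX_notPT _ htX) (fun h => hX_notPool _ htX (hUP h)),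
        sum_insert (fun h => hX_notPool _ htX (hUP (mem_filter.1 h).1)), hsX _ htX]
  have hmassT : ∑ j ∈ T, |z j| = -(∑ j ∈ T, z j) := by
    rw [← sum_neg_distrib]
    exact sum_congr rfl fun j hj => abs_of_neg (by have := hNneg j (hTN hj); linarith)
  have hmassP : ∑ j ∈ P, |z j| = Q :=
    sum_congr rfl fun j hj => abs_of_pos (by have := hPpos j hj; linarith)
  have hmassU : ∀ t,
      ∑ j ∈ Used.filter (fun j => τ j = t), |z j| = ∑ j ∈ Used.filter (fun j => τ j = t), z j :=
    fun t => sum_congr rfl fun j hj => abs_of_nonneg (hUsed0 j (mem_filter.1 hj).1)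
  have hU0 : ∀ t, 0 ≤ ∑ j ∈ Used.filter (fun j => τ j = t), z j :=
    fun t => sum_nonneg fun j hj => hUsed0 j (mem_filter.1 hj).1
  -- a leader other than the block leader is outside `P ∪ T` and `Used`
  have hlead : ∀ i, L i ≠ a₀ → L i ∉ P ∪ T ∧ L i ∉ Used := by
    intro i hblk
    constructor
    · intro h
      by_cases h1 : i ∈ P ∪ T
      · exact hblk (hL_PT i h1)
      · by_cases h2 : i ∈ Used
        · rw [hL_U i h2] at h
          have := hLTg _ (hτ i h2); rw [hL_PT _ h] at this
          exact hblk (by rw [hL_U i h2, ← this])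
        · rw [hL_o i h1 h2] at h; exact h1 h
    · intro h
      by_cases h1 : i ∈ P ∪ T
      · exact hblk (hL_PT i h1)
      · by_cases h2 : i ∈ Used
        · rw [hL_U i h2] at h
          exact disjoint_left.1 hdisj (hτ i h2) (hUP h)
        · rw [hL_o i h1 h2] at h; exact h2 h
  -- every target fibre has value in `[-v, 0]`
  have hTgval : ∀ t ∈ Tg, -(v : ℤ) ≤ ∑ j ∈ univ.filter (fun j => L j = t), z j ∧
      ∑ j ∈ univ.filter (fun j => L j = t), z j ≤ 0 := by
    intro t ht
    rw [hres t ht]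
    refine ⟨?_, (hprop t ht).1⟩
    have h2 := hU0 t
    rcases mem_insert.1 ht with rfl | htX
    · rw [hsa]; linarith
    · rw [hsX t htX]; have := hzlo t (hXW htX); linarith
  refine ⟨L, fun i => ?_, fun i hi j => ?_, fun i hi => ?_, fun i hi => ?_, ?_⟩
  · -- idempotent
    by_cases h1 : i ∈ P ∪ T
    · rw [hL_PT i h1, hLa₀]
    · by_cases h2 : i ∈ Used
      · rw [hL_U i h2]; exact hLTg _ (hτ i h2)
      · rw [hL_o i h1 h2, hL_o i h1 h2]
  · -- letters outside `W` are singletons and nobody's leader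
    have hi1 : i ∉ P ∪ T := fun h => hi (hPTW h)
    have hi2 : i ∉ Used := fun h => hi (hPoolW (hUP h))
    by_cases h1 : j ∈ P ∪ T
    · rw [hL_PT j h1]
      exact ⟨fun h => absurd ha₀W (h ▸ hi), fun h => absurd (hPTW (h ▸ h1)) hi⟩
    · by_cases h2 : j ∈ Used
      · rw [hL_U j h2]
        exact ⟨fun h => absurd (hTgW (hτ j h2)) (h ▸ hi), fun h => absurd (hPoolW (hUP (h ▸ h2))) hi⟩
      · rw [hL_o j h1 h2]
  · -- masses
    by_cases hblk : L i = a₀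
    · rw [hblk, hfib₀, sum_union (disjoint_left.2 fun j hj hju => hUsed_notPT j (mem_filter.1 hju).1 hj),
        sum_union (disjoint_left.2 fun j hj hjT => ?_), hmassP, hmassT, hmassU]
      · have h1 := (hprop a₀ (mem_insert_self a₀ X)).1
        rw [hsa, hs₀def] at h1
        have h2 := hs₀lo
        rw [hs₀def] at h2
        linarith
      · exact disjoint_left.1 hdPN hj (hTN hjT)
    · obtain ⟨ht1, ht2⟩ := hlead i hblk
      set t := L i with htdef
      have htW : t ∈ W := hLW i hi
      rw [hfib₁ t ht1 ht2, sum_insert (fun h => ht2 (mem_filter.1 h).1), hmassU]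
      by_cases htX : t ∈ X
      · have h1 := (hprop t (mem_insert_of_mem htX)).1
        rw [hsX t htX] at h1
        have := hz t htW; have := abs_nonneg (z t)
        have : ∑ j ∈ Used.filter (fun j => τ j = t), z j ≤ |z t| := by
          have := neg_abs_le (z t); linarith
        linarith
      · have hemp : Used.filter (fun j => τ j = t) = ∅ := by
          refine filter_false_of_mem fun j hj h => ?_
          have := hτ j hj; rw [h] at this
          rcases mem_insert.1 this with h' | h'
          · exact ht1 (h' ▸ ha₀)
          · exact htX h'
        rw [hemp, sum_empty, add_zero]
        have := hz t htW; linarith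
  · -- values
    by_cases hblk : L i = a₀
    · rw [hblk]
      have := hTgval a₀ (mem_insert_self a₀ X)
      rw [abs_le]; constructor <;> linarith
    · obtain ⟨ht1, ht2⟩ := hlead i hblk
      set t := L i with htdef
      have htW : t ∈ W := hLW i hi
      by_cases htX : t ∈ X
      · have := hTgval t (mem_insert_of_mem htX)
        rw [abs_le]; constructor <;> linarith
      · have hemp : Used.filter (fun j => τ j = t) = ∅ := by
          refine filter_false_of_mem fun j hj h => ?_
          have := hτ j hj; rw [h] at this
          rcases mem_insert.1 this with h' | h'
          · exact ht1 (h' ▸ ha₀)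
          · exact htX h'
        rw [hfib₁ t ht1 ht2, sum_insert (fun h => ht2 (mem_filter.1 h).1), hemp, sum_empty, add_zero]
        exact hz t htW
  · -- no overshoot: stale leaders are targets; a stale target certifies that the pool is exhausted
    set St := univ.filter (fun i => i ∈ W ∧ L i = i ∧
      (e : ℤ) < |∑ j ∈ univ.filter (fun j => L j = i), z j|) with hStdef
    have hStTg : St ⊆ Tg.filter (fun t => (e : ℤ) < |∑ j ∈ univ.filter (fun j => L j = t), z j|) := by
      intro i hi
      rw [mem_filter] at hi ⊢
      obtain ⟨_, hiW, hLi, hst⟩ := hi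
      refine ⟨?_, hst⟩
      by_contra hiTg
      have hi1 : i ∉ P ∪ T := fun h => hiTg (by rw [← hLi, hL_PT i h]; exact mem_insert_self _ _)
      have hi2 : i ∉ Used := fun h => hτne i h (by rw [← hL_U i h]; exact hLi)
      have hemp : Used.filter (fun j => τ j = i) = ∅ :=
        filter_false_of_mem fun j hj h => hiTg (h ▸ hτ j hj)
      rw [hfib₁ i hi1 hi2, hemp, insert_empty, sum_singleton] at hst
      -- `i` is a good: `|z i| ≤ e`
      have hiP : i ∉ P := fun h => hi1 (mem_union_left _ h)
      have hiN : i ∉ Nn := fun h =>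
        hiTg (mem_insert_of_mem (mem_sdiff.2 ⟨h, fun h' => hi1 (mem_union_right _ h')⟩))
      rw [hP, mem_filter, not_and, not_lt] at hiP
      rw [hNn, mem_filter, not_and, not_lt] at hiN
      exact not_lt.2 (abs_le.2 ⟨hiN hiW, hiP hiW⟩) hst
    have hStTg' : St ⊆ Tg := hStTg.trans (filter_subset _ _)
    -- the stale fibres are nonpositive, so their signed sum is minus their modulus sum
    have hSt_signed : ∑ i ∈ St, ∑ j ∈ univ.filter (fun j => L j = i), z j =
        -(∑ i ∈ St, |∑ j ∈ univ.filter (fun j => L j = i), z j|) := by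
      rw [← sum_neg_distrib]
      refine sum_congr rfl fun i hi => ?_
      rw [abs_of_nonpos (hTgval i (hStTg' hi)).2, neg_neg]
    rcases (Tg.filter (fun t => (e : ℤ) < |∑ j ∈ univ.filter (fun j => L j = t), z j|)).eq_empty_or_nonempty
      with hemp | ⟨t₀, ht₀⟩
    · have hSt0 : St = ∅ := subset_empty.1 (by rw [hemp] at hStTg; exact hStTg)
      rw [hSt0, sum_empty, sum_empty, sub_zero, zero_add]
    · -- some target is stale, so the pool is exhausted
      obtain ⟨ht₀Tg, ht₀st⟩ := mem_filter.1 ht₀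
      have hexh : Used = Pool := by
        rcases (hprop t₀ ht₀Tg).2 with h | h
        · exfalso
          rw [hres t₀ ht₀Tg] at ht₀st
          have h1 := (hprop t₀ ht₀Tg).1
          rw [abs_of_nonpos h1] at ht₀st; linarith
        · exact h
      have hmain : ∑ i ∈ St, |∑ j ∈ univ.filter (fun j => L j = i), z j| ≤
          -(∑ j ∈ W, z j) + ∑ j ∈ Gm, z j := by
        calc ∑ i ∈ St, |∑ j ∈ univ.filter (fun j => L j = i), z j|
            ≤ ∑ t ∈ Tg, |∑ j ∈ univ.filter (fun j => L j = t), z j| :=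
              (sum_le_sum_of_subset_of_nonneg hStTg (fun _ _ _ => abs_nonneg _)).trans
                (sum_le_sum_of_subset_of_nonneg (filter_subset _ _) fun _ _ _ => abs_nonneg _)
          _ = ∑ t ∈ Tg, -(s t + ∑ j ∈ Used.filter (fun j => τ j = t), z j) :=
              sum_congr rfl fun t ht => by rw [hres t ht, abs_of_nonpos (hprop t ht).1]
          _ = -(∑ t ∈ Tg, s t) - ∑ j ∈ Used, z j := by
              rw [sum_neg_distrib, sum_add_distrib, sum_fiberwise_of_maps_to (fun j hj => hτ j hj)]; ring
          _ = -(s₀ + ∑ x ∈ X, z x) - ∑ j ∈ Pool, z j := by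
              rw [hexh, hTgdef, sum_insert ha₀X, hsa, sum_congr rfl hsX]
          _ = -(∑ j ∈ W, z j) + ∑ j ∈ Gm, z j := by
              rw [hsplit, hs₀def, hQdef, hXdef, sum_sdiff_eq_sub hTN]; ring
      have hSt0 : 0 ≤ ∑ i ∈ St, |∑ j ∈ univ.filter (fun j => L j = i), z j| :=
        sum_nonneg fun _ _ => abs_nonneg _
      rw [hSt_signed, sub_neg_eq_add, abs_of_nonpos (by linarith), abs_of_nonpos (by linarith)]
      linarith

end Summit.ValiantsHypothesis.ValiantsHypothesis.Theorems.DepthWindow.TreeBias
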